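import Summits.CriticalPhenomena.CardyFormulaZ2.Theorems.CardyBoundaryCoulombGasBoundaryDefectGaussianRStubRealisabilityPart38
import Summits.CriticalPhenomena.CardyFormulaZ2.Theorems.CardyBoundaryCoulombGasBoundaryDefectGaussianRStubRealisabilityPart46

/-!
# Stub `s17_eventually_configsNonempty` of the D2 completion (line
# `rainbow-monomials-in-excursion-kernels`, crux `BoundaryDefectGaussianR`,
# stmt-CriticalPhenomena-14132) — Part 7: every prescribed cell of the jump collar sits next to a
# cycle dart carrying its level; parities and signs of the prescribed levels

The prescribed cells of `ι.model V` are the non-free vertex-cells (arc vertices and ghosts, level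
`vertH`) and the non-free face-cells (exterior faces that are no pockets, level `faceH`). For an
ADMISSIBLE `ι` with FLAT insertion points (radius `sinkLegs + 3`) on a `V` with radius-`3` CHARTS
(the hypotheses of `s13_openEdgeLevels`, Part 34), with `ds = cycle V d₀` the boundary cycle from the
sink's dart and `st t` the walk states:

* `pc_vertex_touch` — every prescribed vertex-cell `x` lies within doubled sup-distance `2` of the
  vertex of a cycle dart `ds[t]` and carries a WIRED level at that dart: `vertH x = (st t).level`
  with `st t` wired, or `vertH x = (st (t+1)).level` with `st (t+1)` wired (arc vertex: its own dart,
  `vertH_eq_of_mention`; ghost over a pocket: the pocket's dart, `vertH_pocketCorner`; ghost at the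
  end of a spoke: the dart of the arc vertex, `vertH_spoke`);
* `pc_face_touch` — every prescribed face-cell is the gap face of a cycle dart `ds[t]` followed by
  a FREE stretch, at level `faceH = (st (t+1)).level` (gap faces determine their darts on a
  pinch-free `V`, `exterior_dart_unique`), or it is the gap face of no cycle dart and `faceH = 0`;
* `pc_parity` — hence prescribed vertex levels are odd and `≤ 1`, prescribed face levels even and
  `≤ 0` (`st_wired_iff_odd`, `st_level_mem`): the first two hypotheses of Part 1.
Registered one-line form: `s17_configsNonempty_part7`. All [folklore].
-/

namespace Summit.CriticalPhenomena.CardyFormulaZ2.Cruxes.BoundaryDefectGaussianR.RainbowMonomialsInExcursionKernels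

open Literature.Probability.LatticeModels Literature.Probability.LatticeModels.CollarLegModel

/-- No diagonal pinch at an exterior dart, from `NoPinch` in coordinates: if `u ∈ V`,
`u + dir k ∉ V` and `u + dir (k+1) ∉ V` then the diagonal point `u + dir k + dir (k+1)` is not in
`V`. [folklore] -/
theorem pc_noPinch_dart {V : Finset (ℤ × ℤ)}
    (hNP : ∀ x y : ℤ, ((x, y) ∈ V → (x + 1, y + 1) ∈ V → (x + 1, y) ∈ V ∨ (x, y + 1) ∈ V) ∧
      ((x + 1, y) ∈ V → (x, y + 1) ∈ V → (x, y) ∈ V ∨ (x + 1, y + 1) ∈ V))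
    {u : ℤ × ℤ} {k : Fin 4} (hu : u ∈ V) (hk : u + dir k ∉ V) (hk1 : u + dir (k + 1) ∉ V) :
    u + dir k + dir (k + 1) ∉ V := by
  obtain ⟨a, b⟩ := u
  intro hd
  fin_cases k
  · have h1 : (a + 1, b) ∉ V := nmem_of_eq hk (by simp [dir])
    have h2 : (a, b + 1) ∉ V := nmem_of_eq hk1 (by simp [dir])
    have h3 : (a + 1, b + 1) ∈ V := mem_of_eq hd (by simp [dir])
    rcases (hNP a b).1 hu h3 with h | h
    · exact h1 h
    · exact h2 h
  · have h1 : (a, b + 1) ∉ V := nmem_of_eq hk (by simp [dir])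
    have h2 : (a - 1, b) ∉ V := nmem_of_eq hk1 (by simp [dir]; ring)
    have h3 : (a - 1, b + 1) ∈ V := mem_of_eq hd (by simp [dir]; ring)
    rcases (hNP (a - 1) b).2 (mem_of_eq hu (by simp)) h3 with h | h
    · exact h2 h
    · exact h1 (mem_of_eq h (by simp))
  · have h1 : (a - 1, b) ∉ V := nmem_of_eq hk (by simp [dir]; ring)
    have h2 : (a, b - 1) ∉ V := nmem_of_eq hk1 (by simp [dir]; ring)
    have h3 : (a - 1, b - 1) ∈ V := mem_of_eq hd (by simp [dir]; constructor <;> ring)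
    rcases (hNP (a - 1) (b - 1)).1 h3 (mem_of_eq hu (by simp)) with h | h
    · exact h2 (mem_of_eq h (by simp))
    · exact h1 (mem_of_eq h (by simp))
  · have h1 : (a, b - 1) ∉ V := nmem_of_eq hk (by simp [dir]; ring)
    have h2 : (a + 1, b) ∉ V := nmem_of_eq hk1 (by simp [dir])
    have h3 : (a + 1, b - 1) ∈ V := mem_of_eq hd (by simp [dir]; ring)
    rcases (hNP a (b - 1)).2 h3 (mem_of_eq hu (by simp)) with h | h
    · exact h1 h
    · exact h2 (mem_of_eq h (by simp))

/-- Lattice neighbours are at doubled sup-distance `2`. [folklore] -/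
theorem pc_dist_dir (y : ℤ × ℤ) (j : Fin 4) :
    max |2 * (y + dir j).1 - 2 * y.1| |2 * (y + dir j).2 - 2 * y.2| ≤ 2 := by
  obtain ⟨a, b⟩ := y
  fin_cases j <;> simp [dir] <;> norm_num [mul_add]

/-- The corners of the gap face of a dart are within doubled sup-distance `2` of its vertex.
[folklore] -/
theorem pc_dist_corner (u x : ℤ × ℤ) (k : Fin 4) (hx : x ∈ SixVertex.faceCorners (gapFace (u, k))) :
    max |2 * x.1 - 2 * u.1| |2 * x.2 - 2 * u.2| ≤ 2 := by
  rw [mem_faceCorners_gapFace] at hx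
  obtain ⟨a, b⟩ := u
  rcases hx with rfl | rfl | rfl | rfl <;> fin_cases k <;> simp [dir] <;> norm_num [mul_add, mul_sub]

section Admissible

variable (ι : LegInsertionData) (V : Finset (ℤ × ℤ)) {d₀ : Dart} (hadm : ι.IsAdmissible V)
  (h0 : outDart V ι.sink = some d₀) {st : ℕ → WalkState}
  (hst : ∀ t, st t = List.foldl (fun s d => s.step (ι.startAt V d)) ι.init ((cycle V d₀).take t))
  (hflat : ∀ x ∈ insert ι.sink ι.source, ∃ dvec : ℤ × ℤ,
    (dvec = (1, 0) ∨ dvec = (-1, 0) ∨ dvec = (0, 1) ∨ dvec = (0, -1)) ∧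
    ∀ v : ℤ × ℤ, (v.1 - x.1) ^ 2 + (v.2 - x.2) ^ 2 ≤ ((ι.sinkLegs : ℤ) + 3) ^ 2 →
      (v ∈ V ↔ 0 ≤ (v.1 - x.1) * dvec.1 + (v.2 - x.2) * dvec.2))
  (hchart : ∀ u ∈ V, ∀ k : Fin 4, u + dir k ∉ V → ∃ (K : Fin 4) (c₁ c₂ : ℤ),
    (∀ v : ℤ × ℤ, |v.1 - u.1| ≤ 3 → |v.2 - u.2| ≤ 3 →
      (v ∈ V ↔ c₂ ≤ v.1 * (dir (K + 1)).1 + v.2 * (dir (K + 1)).2)) ∨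
    (∀ v : ℤ × ℤ, |v.1 - u.1| ≤ 3 → |v.2 - u.2| ≤ 3 →
      (v ∈ V ↔ c₁ ≤ v.1 * (dir K).1 + v.2 * (dir K).2 ∧
        c₂ ≤ v.1 * (dir (K + 1)).1 + v.2 * (dir (K + 1)).2)) ∨
    (∀ v : ℤ × ℤ, |v.1 - u.1| ≤ 3 → |v.2 - u.2| ≤ 3 →
      (v ∈ V ↔ c₂ ≤ v.1 * (dir (K + 1)).1 + v.2 * (dir (K + 1)).2 ∨
        v.1 * (dir K).1 + v.2 * (dir K).2 ≤ c₁)))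

include hadm h0 hst hflat hchart in
/-- **An arc vertex carries a wired level at its own dart.** [folklore] -/
theorem pc_arc_level {x : ℤ × ℤ} (harc : x ∈ (ι.collar V).arc) :
    ∃ t, ∃ ht : t < (cycle V d₀).length, ((cycle V d₀)[t]).1 = x ∧
      (((st t).wired = true ∧ (ι.collar V).vertH x = (st t).level) ∨
        ((st (t + 1)).wired = true ∧ (ι.collar V).vertH x = (st (t + 1)).level)) := by
  obtain ⟨t, ht, hw, hxt⟩ := (mem_collar_arc_iff ι V h0 hst).1 harc
  have hm := mention_of_vertex V (e := ((cycle V d₀)[t], st t, st (t + 1))) hw (Or.inl hxt)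
  have hv := vertH_eq_of_mention ι V hadm h0 hst hflat hchart ht hm
  refine ⟨t, ht, hxt, ?_⟩
  by_cases hwt : (st t).wired = true
  · left; rw [hv, if_pos hwt]; exact ⟨hwt, rfl⟩
  · right; rw [hv, if_neg hwt]; exact ⟨hw.resolve_left hwt, rfl⟩

include hadm h0 hst hflat hchart in
/-- **Every prescribed vertex-cell sits next to a cycle dart carrying its (wired) level.** A
non-free vertex-cell `x` of the jump collar (an arc vertex or a ghost) lies within doubled
sup-distance `2` of the vertex of some cycle dart `ds[t]`, and `vertH x` is the level of a wired
state at that dart: `(st t).level` with `st t` wired, or `(st (t + 1)).level` with `st (t + 1)`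
wired. [folklore] -/
theorem pc_vertex_touch {x : ℤ × ℤ} (hx : x ∈ (ι.model V).vertexCells)
    (hxf : (x, false) ∉ (ι.model V).freeCells) :
    ∃ t, ∃ ht : t < (cycle V d₀).length,
      max |2 * x.1 - 2 * ((cycle V d₀)[t]).1.1| |2 * x.2 - 2 * ((cycle V d₀)[t]).1.2| ≤ 2 ∧
      (((st t).wired = true ∧ (ι.model V).C.vertH x = (st t).level) ∨
        ((st (t + 1)).wired = true ∧ (ι.model V).C.vertH x = (st (t + 1)).level)) := by
  change ∃ t, ∃ ht : t < (cycle V d₀).length, _ ∧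
      (((st t).wired = true ∧ (ι.collar V).vertH x = (st t).level) ∨
        ((st (t + 1)).wired = true ∧ (ι.collar V).vertH x = (st (t + 1)).level))
  rcases mem_arc_or_ghosts_of_not_mem_freeCells (ι.model V) hx hxf with ⟨-, harc⟩ | ⟨hxV, hg⟩
  · -- an arc vertex: its own dart
    obtain ⟨t, ht, hxt, hlev⟩ := pc_arc_level ι V hadm h0 hst hflat hchart harc
    refine ⟨t, ht, ?_, hlev⟩
    rw [hxt]; simp
  · change x ∉ V at hxV
    have hg' := (Finset.mem_sdiff.mp hg).1
    rcases Finset.mem_union.mp hg' with h1 | h2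
    · -- a ghost at the end of a spoke from the arc vertex `y`
      obtain ⟨y, hy, hxy⟩ := Finset.mem_biUnion.mp h1
      obtain ⟨hyarc, -⟩ := Finset.mem_inter.mp hy
      obtain ⟨j, rfl⟩ := mem_neighbours_iff.mp hxy
      have hsp := vertH_spoke ι V hadm h0 hst hflat hchart hyarc hxV (k' := j) rfl
      obtain ⟨t, ht, hyt, hlev⟩ := pc_arc_level ι V hadm h0 hst hflat hchart hyarc
      refine ⟨t, ht, ?_, ?_⟩
      · rw [hyt]; exact pc_dist_dir y j
      · rw [← hsp]; exact hlev
    · -- a ghost at an outside corner of a pocket: the pocket's dart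
      obtain ⟨p, hp, hxp⟩ := Finset.mem_biUnion.mp h2
      obtain ⟨hpC, -⟩ := Finset.mem_inter.mp hp
      obtain ⟨t, ht, hw, hgp⟩ := (mem_collar_pocket_iff ι V h0 hst).1 hpC
      rw [← hgp] at hxp
      have hv := vertH_pocketCorner ι V hadm h0 hst hflat hchart ht hw hxp hxV
      refine ⟨t, ht, ?_, ?_⟩
      · have hd := pc_dist_corner ((cycle V d₀)[t]).1 x ((cycle V d₀)[t]).2 (by rw [Prod.mk.eta]; exact hxp)
        exact hd
      · by_cases hwt : (st t).wired = true
        · left; rw [hv, if_pos hwt]; exact ⟨hwt, rfl⟩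
        · right; rw [hv, if_neg hwt]; exact ⟨hw, rfl⟩

include hadm h0 hst hchart in
/-- **Every prescribed face-cell is the gap face of a cycle dart followed by a free stretch, at
the level after that dart — or of no cycle dart, at the default level `0`.** [folklore] -/
theorem pc_face_touch {f : ℤ × ℤ} (hff : (f, true) ∉ (ι.model V).freeCells) :
    (∃ t, ∃ ht : t < (cycle V d₀).length, gapFace (cycle V d₀)[t] = f ∧
      (st (t + 1)).wired = false ∧ (ι.model V).C.faceH f = (st (t + 1)).level) ∨
    ((ι.model V).C.faceH f = 0 ∧ ∀ t, ∀ ht : t < (cycle V d₀).length, gapFace (cycle V d₀)[t] ≠ f) := by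
  change (∃ t, ∃ ht : t < (cycle V d₀).length, gapFace (cycle V d₀)[t] = f ∧
      (st (t + 1)).wired = false ∧ (ι.collar V).faceH f = (st (t + 1)).level) ∨
    ((ι.collar V).faceH f = 0 ∧ ∀ t, ∀ ht : t < (cycle V d₀).length, gapFace (cycle V d₀)[t] ≠ f)
  obtain ⟨hv₀, ht₀⟩ := sinkDart_exterior ι V hadm h0
  have hNP := tc_noPinch_of_chart hchart
  -- a gap face of a cycle dart is met on a free stretch (else it would be a pocket, hence free)
  have hfree : ∀ t, ∀ ht : t < (cycle V d₀).length, gapFace (cycle V d₀)[t] = f →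
      (st (t + 1)).wired = false := by
    intro t ht hg
    by_contra hw
    have hw' : (st (t + 1)).wired = true := by simpa using hw
    have hpk : f ∈ (ι.collar V).pocket := (mem_collar_pocket_iff ι V h0 hst).2 ⟨t, ht, hw', hg⟩
    obtain ⟨hu, huk⟩ := cycle_getElem_exterior ι V hadm h0 ht
    have hbd : f ∈ SixVertex.bdryFaces V := by
      have := (gapFace_mem_bdryFaces hu huk).1
      rwa [Prod.mk.eta, hg] at this
    apply hff
    rw [mem_freeCells_true]
    exact Finset.mem_union_right _ (Finset.mem_inter.2 ⟨hpk, hbd⟩)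
  by_cases hex : ∃ t, ∃ ht : t < (cycle V d₀).length, gapFace (cycle V d₀)[t] = f
  · obtain ⟨t, ht, hg⟩ := hex
    refine Or.inl ⟨t, ht, hg, hfree t ht hg, ?_⟩
    rw [← hg]
    refine collar_faceH_gapFace ι V h0 hst ht (hfree t ht hg) fun t' ht' _ hg' => ?_
    -- the gap face determines the dart: `t' = t`
    exfalso
    obtain ⟨hu, huk⟩ := cycle_getElem_exterior ι V hadm h0 ht
    obtain ⟨hu', huk'⟩ := cycle_getElem_exterior ι V hadm h0 (t := t') (by omega)
    have huniq := exterior_dart_unique (V := V) (x := ((cycle V d₀)[t]).1) (k := ((cycle V d₀)[t]).2)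
      (v := ((cycle V d₀)[t']).1) (i := ((cycle V d₀)[t']).2) hu huk
      (fun h1 => pc_noPinch_dart hNP hu huk h1) hu' huk' (by rw [Prod.mk.eta, Prod.mk.eta]; exact hg')
    rw [Prod.mk.eta, Prod.mk.eta] at huniq
    have := cycle_inj hv₀ ht₀ huniq
    omega
  · refine Or.inr ⟨collar_faceH_eq_zero ι V h0 hst fun t ht _ hg => hex ⟨t, ht, hg⟩, ?_⟩
    exact fun t ht hg => hex ⟨t, ht, hg⟩

include hadm h0 hst hflat hchart in
/-- **Parities and signs of the prescribed levels**: odd and `≤ 1` (indeed `≤ 0`) on the non-free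
vertex-cells, even and `≤ 0` on the non-free face-cells — the first two hypotheses of the distance
transform (Part 1). [folklore] -/
theorem pc_parity :
    (∀ x ∈ (ι.model V).vertexCells, (x, false) ∉ (ι.model V).freeCells →
      (ι.model V).C.vertH x % 2 = 1 ∧ (ι.model V).C.vertH x ≤ 1) ∧
    (∀ f ∈ (ι.model V).faceCells, (f, true) ∉ (ι.model V).freeCells →
      (ι.model V).C.faceH f % 2 = 0 ∧ (ι.model V).C.faceH f ≤ 0) := by
  constructor
  · intro x hx hxf
    obtain ⟨t, ht, -, hlev⟩ := pc_vertex_touch ι V hadm h0 hst hflat hchart hx hxf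
    rcases hlev with ⟨hw, hv⟩ | ⟨hw, hv⟩
    · have h1 := (st_wired_iff_odd ι V hadm h0 hst ht.le).1 hw
      have h2 := (st_level_mem ι V hadm h0 hst ht.le).2
      rw [hv]; exact ⟨h1, by omega⟩
    · have h1 := (st_wired_iff_odd ι V hadm h0 hst (t := t + 1) (by omega)).1 hw
      have h2 := (st_level_mem ι V hadm h0 hst (t := t + 1) (by omega)).2
      rw [hv]; exact ⟨h1, by omega⟩
  · intro f _ hff
    rcases pc_face_touch ι V hadm h0 hst hchart hff with ⟨t, ht, -, hw, hv⟩ | ⟨hv, -⟩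
    · have h1 := st_wired_iff_odd ι V hadm h0 hst (t := t + 1) (by omega)
      rw [hw] at h1
      have h2 := (st_level_mem ι V hadm h0 hst (t := t + 1) (by omega)).2
      rw [hv]
      refine ⟨?_, h2⟩
      rcases Int.emod_two_eq_zero_or_one (st (t + 1)).level with h | h
      · exact h
      · exact absurd (h1.2 h) (by simp)
    · rw [hv]; exact ⟨rfl, le_rfl⟩

end Admissible

/-! ### Registered one-line form -/

/-- **Registered sub-goal `s17_configsNonempty_part7`** of `s17_eventually_configsNonempty`
(stmt-CriticalPhenomena-14132): for an admissible leg insertion with FLAT insertion points (radius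
`sinkLegs + 3`) on a `V` with radius-`3` CHARTS, the prescribed levels of the jump collar are odd and
`≤ 1` on the non-free vertex-cells, even and `≤ 0` on the non-free face-cells (one-line form of
`pc_parity`). [folklore] -/
theorem s17_configsNonempty_part7 : ∀ (ι : Literature.Probability.LatticeModels.CollarLegModel.LegInsertionData) (V : Finset (ℤ × ℤ)), ι.IsAdmissible V → (∀ x ∈ insert ι.sink ι.source, ∃ dvec : ℤ × ℤ, (dvec = (1, 0) ∨ dvec = (-1, 0) ∨ dvec = (0, 1) ∨ dvec = (0, -1)) ∧ ∀ v : ℤ × ℤ, (v.1 - x.1) ^ 2 + (v.2 - x.2) ^ 2 ≤ ((ι.sinkLegs : ℤ) + 3) ^ 2 → (v ∈ V ↔ 0 ≤ (v.1 - x.1) * dvec.1 + (v.2 - x.2) * dvec.2)) → (∀ u ∈ V, ∀ k : Fin 4, u + Literature.Probability.LatticeModels.CollarLegModel.dir k ∉ V → ∃ (K : Fin 4) (c₁ c₂ : ℤ), (∀ v : ℤ × ℤ, |v.1 - u.1| ≤ 3 → |v.2 - u.2| ≤ 3 → (v ∈ V ↔ c₂ ≤ v.1 * (Literature.Probability.LatticeModels.CollarLegModel.dir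 (K + 1)).1 + v.2 * (Literature.Probability.LatticeModels.CollarLegModel.dir (K + 1)).2)) ∨ (∀ v : ℤ × ℤ, |v.1 - u.1| ≤ 3 → |v.2 - u.2| ≤ 3 → (v ∈ V ↔ c₁ ≤ v.1 * (Literature.Probability.LatticeModels.CollarLegModel.dir K).1 + v.2 * (Literature.Probability.LatticeModels.CollarLegModel.dir K).2 ∧ c₂ ≤ v.1 * (Literature.Probability.LatticeModels.CollarLegModel.dir (K + 1)).1 + v.2 * (Literature.Probability.LatticeModels.CollarLegModel.dir (K + 1)).2)) ∨ (∀ v : ℤ × ℤ, |v.1 - u.1| ≤ 3 → |v.2 - u.2| ≤ 3 → (v ∈ V ↔ c₂ ≤ v.1 * (Literature.Probability.LatticeModels.CollarLegModel.dir (K + 1)).1 + v.2 * (Literature.Probability.LatticeModels.CollarLegModel.dir (K + 1)).2 ∨ v.1 * (Literature.Probability.LatticeModels.CollarLegModel.dir K).1 + v.2 * (Literature.Probability.LatticeModels.CollarLegModel.dir K).2 ≤ c₁))) → (∀ x ∈ (Literature.Probability.LatticeModels.CollarLegModel.LegInsertionData.model ι V).vertexCells, (x, false) ∉ (Literature.Probability.LatticeModels.CollarLegModel.LegInsertionData.model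 ι V).freeCells → (Literature.Probability.LatticeModels.CollarLegModel.LegInsertionData.model ι V).C.vertH x % 2 = 1 ∧ (Literature.Probability.LatticeModels.CollarLegModel.LegInsertionData.model ι V).C.vertH x ≤ 1) ∧ (∀ f ∈ (Literature.Probability.LatticeModels.CollarLegModel.LegInsertionData.model ι V).faceCells, (f, true) ∉ (Literature.Probability.LatticeModels.CollarLegModel.LegInsertionData.model ι V).freeCells → (Literature.Probability.LatticeModels.CollarLegModel.LegInsertionData.model ι V).C.faceH f % 2 = 0 ∧ (Literature.Probability.LatticeModels.CollarLegModel.LegInsertionData.model ι V).C.faceH f ≤ 0) := by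
  intro ι V hadm hflat hchart
  obtain ⟨d₀, h0, -, -, -, -⟩ := s3_of_admissible ι V hadm
  exact pc_parity ι V hadm h0 (st := fun t => List.foldl (fun s d => s.step (ι.startAt V d)) ι.init
    ((cycle V d₀).take t)) (fun _ => rfl) hflat hchart

end Summit.CriticalPhenomena.CardyFormulaZ2.Cruxes.BoundaryDefectGaussianR.RainbowMonomialsInExcursionKernels
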